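import Summits.Ventures.PercRepro2.CaseOnePendantTree

/-!
# Pendant trees at the four closed anchors
(blind cell PercRepro2, p1 g22; S5 §2.1: `fourForms_of_pendantTree` at the marked-star, uwob-gadget,
roots-only and roots-and-`o` anchors)

The four classes closed on all four forms `(ii)`, `(ii-Q)`, `(i)`, `(i-Q)` in the tree — the marked star
(`MarkedStarAnchor`), the uwob gadget (`GadgetUWOBAnchor`), the roots-only vertex (`RootsOnlyAnchor`) and
the roots-and-`o` vertex (`RootsAndOAnchor`), with their `fourForms_of_…Anchor` lemmas of
`CaseOnePendantPath` / `CaseOnePendantPathRoots` — are fed to `fourForms_of_pendantTree`: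
**every row of the class table — `(ii)`, `(ii-Q)`, `(i)`, `(i-Q)`, `(J1₁)`, `(J1)`, `(RV)` — at EVERY
vertex of EVERY pendant tree (any number of branches at any vertex, any depth) hanging at such a
vertex**, for every finite graph and every weight vector (`fourForms_of_pendantTree_markedStar`,
`jOne_of_pendantTree_markedStar`, `rv_of_pendantTree_markedStar`, and the same for `gadgetUWOB`,
`rootsOnly`, `rootsAndO`). The pendant paths of `CaseOnePendantPath(Roots)` are the trees with one
branch; the pendant classes are the trees with one edge; the closers themselves the trees with none.
Own code; standard axioms. -/

namespace Summit.Ventures.PercRepro2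

namespace CaseOne

universe u

section Anchors
variable {V : Type*} [Fintype V] [DecidableEq V] {R : Type*} [Field R] [LinearOrder R]
  [IsStrictOrderedRing R]
variable (o a₁ a₂ b : V)
variable {E : Type u} [Fintype E] [DecidableEq E] {ends : E → Sym2 V} {v y : V} {S : Set V} {n : ℕ}

/-! ### The marked-star anchor -/

/-- **The four forms at every vertex of a pendant tree at a marked-star vertex**, every finite graph,
every weight vector. -/
theorem fourForms_of_pendantTree_markedStar (p : E → R) (hp : IsProbVec p)
    (h : IsPendantTreeAt (MarkedStarAnchor o a₁ a₂ b) o a₁ a₂ b n E ends v S) (hy : y ∈ S) :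
    FourForms p ends o a₁ a₂ y b :=
  fourForms_of_pendantTree (MarkedStarAnchor o a₁ a₂ b) o a₁ a₂ b
    (fourForms_of_markedStarAnchor o a₁ a₂ b) n E ends p hp v S h y hy

/-- **`(J1)` at every vertex of a pendant tree at a marked-star vertex.** -/
theorem jOne_of_pendantTree_markedStar (p : E → R) (hp : IsProbVec p)
    (h : IsPendantTreeAt (MarkedStarAnchor o a₁ a₂ b) o a₁ a₂ b n E ends v S) (hy : y ∈ S) :
    JOne p ends o a₁ a₂ y b :=
  jOne_of_pendantTree (MarkedStarAnchor o a₁ a₂ b) (fourForms_of_markedStarAnchor o a₁ a₂ b)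
    (fun E' _ _ ends' p' hp' v' h' =>
      fourForms_of_markedStarAnchor o a₂ a₁ b E' ends' p' hp' v' (MarkedStarAnchor.swap o a₁ a₂ b E' ends' v' h'))
    p hp h hy

/-- **`(RV)` at every vertex of a pendant tree at a marked-star vertex.** -/
theorem rv_of_pendantTree_markedStar (p : E → R) (hp : IsProbVec p)
    (h : IsPendantTreeAt (MarkedStarAnchor o a₁ a₂ b) o a₁ a₂ b n E ends v S) (hy : y ∈ S)
    (hT : 0 < prob p (Tp ends a₁ a₂ y)) : RV p ends o a₁ a₂ y b :=
  rv_of_pendantTree (MarkedStarAnchor o a₁ a₂ b) (fourForms_of_markedStarAnchor o a₁ a₂ b) p hp h hy hT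

/-! ### The uwob-gadget anchor -/

/-- **The four forms at every vertex of a pendant tree at a uwob-gadget vertex**, every finite graph,
every weight vector. -/
theorem fourForms_of_pendantTree_gadgetUWOB (p : E → R) (hp : IsProbVec p)
    (h : IsPendantTreeAt (GadgetUWOBAnchor o a₁ a₂ b) o a₁ a₂ b n E ends v S) (hy : y ∈ S) :
    FourForms p ends o a₁ a₂ y b :=
  fourForms_of_pendantTree (GadgetUWOBAnchor o a₁ a₂ b) o a₁ a₂ b
    (fourForms_of_gadgetUWOBAnchor o a₁ a₂ b) n E ends p hp v S h y hy

/-- **`(J1)` at every vertex of a pendant tree at a uwob-gadget vertex.** -/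
theorem jOne_of_pendantTree_gadgetUWOB (p : E → R) (hp : IsProbVec p)
    (h : IsPendantTreeAt (GadgetUWOBAnchor o a₁ a₂ b) o a₁ a₂ b n E ends v S) (hy : y ∈ S) :
    JOne p ends o a₁ a₂ y b :=
  jOne_of_pendantTree (GadgetUWOBAnchor o a₁ a₂ b) (fourForms_of_gadgetUWOBAnchor o a₁ a₂ b)
    (fun E' _ _ ends' p' hp' v' h' =>
      fourForms_of_gadgetUWOBAnchor o a₂ a₁ b E' ends' p' hp' v' (GadgetUWOBAnchor.swap o a₁ a₂ b E' ends' v' h'))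
    p hp h hy

/-- **`(RV)` at every vertex of a pendant tree at a uwob-gadget vertex.** -/
theorem rv_of_pendantTree_gadgetUWOB (p : E → R) (hp : IsProbVec p)
    (h : IsPendantTreeAt (GadgetUWOBAnchor o a₁ a₂ b) o a₁ a₂ b n E ends v S) (hy : y ∈ S)
    (hT : 0 < prob p (Tp ends a₁ a₂ y)) : RV p ends o a₁ a₂ y b :=
  rv_of_pendantTree (GadgetUWOBAnchor o a₁ a₂ b) (fourForms_of_gadgetUWOBAnchor o a₁ a₂ b) p hp h hy hT

/-! ### The roots-only anchor -/

/-- **The four forms at every vertex of a pendant tree at a roots-only vertex**, every finite graph,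
every weight vector. -/
theorem fourForms_of_pendantTree_rootsOnly (p : E → R) (hp : IsProbVec p)
    (h : IsPendantTreeAt (RootsOnlyAnchor o a₁ a₂ b) o a₁ a₂ b n E ends v S) (hy : y ∈ S) :
    FourForms p ends o a₁ a₂ y b :=
  fourForms_of_pendantTree (RootsOnlyAnchor o a₁ a₂ b) o a₁ a₂ b
    (fourForms_of_rootsOnlyAnchor o a₁ a₂ b) n E ends p hp v S h y hy

/-- **`(J1)` at every vertex of a pendant tree at a roots-only vertex.** -/
theorem jOne_of_pendantTree_rootsOnly (p : E → R) (hp : IsProbVec p)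
    (h : IsPendantTreeAt (RootsOnlyAnchor o a₁ a₂ b) o a₁ a₂ b n E ends v S) (hy : y ∈ S) :
    JOne p ends o a₁ a₂ y b :=
  jOne_of_pendantTree (RootsOnlyAnchor o a₁ a₂ b) (fourForms_of_rootsOnlyAnchor o a₁ a₂ b)
    (fun E' _ _ ends' p' hp' v' h' =>
      fourForms_of_rootsOnlyAnchor o a₂ a₁ b E' ends' p' hp' v' (RootsOnlyAnchor.swap o a₁ a₂ b E' ends' v' h'))
    p hp h hy

/-- **`(RV)` at every vertex of a pendant tree at a roots-only vertex.** -/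
theorem rv_of_pendantTree_rootsOnly (p : E → R) (hp : IsProbVec p)
    (h : IsPendantTreeAt (RootsOnlyAnchor o a₁ a₂ b) o a₁ a₂ b n E ends v S) (hy : y ∈ S)
    (hT : 0 < prob p (Tp ends a₁ a₂ y)) : RV p ends o a₁ a₂ y b :=
  rv_of_pendantTree (RootsOnlyAnchor o a₁ a₂ b) (fourForms_of_rootsOnlyAnchor o a₁ a₂ b) p hp h hy hT

/-! ### The roots-and-`o` anchor -/

/-- **The four forms at every vertex of a pendant tree at a roots-and-`o` vertex**, every finite graph,
every weight vector. -/
theorem fourForms_of_pendantTree_rootsAndO (p : E → R) (hp : IsProbVec p)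
    (h : IsPendantTreeAt (RootsAndOAnchor o a₁ a₂ b) o a₁ a₂ b n E ends v S) (hy : y ∈ S) :
    FourForms p ends o a₁ a₂ y b :=
  fourForms_of_pendantTree (RootsAndOAnchor o a₁ a₂ b) o a₁ a₂ b
    (fourForms_of_rootsAndOAnchor o a₁ a₂ b) n E ends p hp v S h y hy

/-- **`(J1)` at every vertex of a pendant tree at a roots-and-`o` vertex.** -/
theorem jOne_of_pendantTree_rootsAndO (p : E → R) (hp : IsProbVec p)
    (h : IsPendantTreeAt (RootsAndOAnchor o a₁ a₂ b) o a₁ a₂ b n E ends v S) (hy : y ∈ S) :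
    JOne p ends o a₁ a₂ y b :=
  jOne_of_pendantTree (RootsAndOAnchor o a₁ a₂ b) (fourForms_of_rootsAndOAnchor o a₁ a₂ b)
    (fun E' _ _ ends' p' hp' v' h' =>
      fourForms_of_rootsAndOAnchor o a₂ a₁ b E' ends' p' hp' v' (RootsAndOAnchor.swap o a₁ a₂ b E' ends' v' h'))
    p hp h hy

/-- **`(RV)` at every vertex of a pendant tree at a roots-and-`o` vertex.** -/
theorem rv_of_pendantTree_rootsAndO (p : E → R) (hp : IsProbVec p)
    (h : IsPendantTreeAt (RootsAndOAnchor o a₁ a₂ b) o a₁ a₂ b n E ends v S) (hy : y ∈ S)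
    (hT : 0 < prob p (Tp ends a₁ a₂ y)) : RV p ends o a₁ a₂ y b :=
  rv_of_pendantTree (RootsAndOAnchor o a₁ a₂ b) (fourForms_of_rootsAndOAnchor o a₁ a₂ b) p hp h hy hT

end Anchors

end CaseOne

end Summit.Ventures.PercRepro2
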